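import Literature.NumberTheory.LFunctions.ChebotarevNaturalUpperBoundProofs
import Literature.GroupTheory.SquareCentralProofs
import HarnessLib

/-!
# Upper natural density `≤ 2 #T/#G` for the Frobenius set of `T = {g : g² ∈ Z}`, `Z` central

Topic `Literature/NumberTheory/LFunctions`; namespace `Literature.NumberTheory.LFunctions.Chebotarev`
(that of `ChebotarevDensity.lean`, `ChebotarevNaturalUpperBoundProofs.lean`).  Everything in this
file is PROVED (theorems only, nothing is defined, no named fact); the only analytic input is the
prime ideal theorem, through `ChebotarevNaturalUpperBoundProofs`.

`ChebotarevNaturalUpperBoundProofs` bounds the upper natural density of a Frobenius set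
`frobPrimes φ C` (`φ : Γ_ℚ ↠ G` finite, open kernel) by `1/k` whenever one subgroup `H ≤ G` has the
property that every `g ∈ C` has `≥ k` fixed points on `G/H`.  Here this is upgraded, for the
special conjugation-stable sets
`T = {g ∈ G : g² ∈ Z}` with `Z ≤ Z(G)` **central** (for `G ≤ GL₂` and `Z` the scalars: the
elements that are involutions or trivial in `PGL₂` — e.g. the Frobenius elements at the
supersingular primes `p ≥ 5` of an elliptic curve over `ℚ`, of characteristic polynomial `X² + p`),
to a bound proportional to the share of `T`:

* `eventually_card_primesLE_filter_natPrimesOf_primesOfFrobIn_sqCentral_le` (finite level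
  `L/ℚ`) and `eventually_card_primesLE_filter_frobPrimes_sqCentral_le` (`Γ_ℚ`-form): for every
  `η > 0`, eventually `#{p ≤ x : p ∈ frobPrimes φ T} ≤ (2 #T/#G + η) π(x)` — **the upper natural
  density of the Frobenius set of `T` is at most `2 #T / #G`** (Chebotarev's theorem would give
  exactly `#T/#G`; the factor `2` is harmless for the application, where `#T/#G → 0` along a tower).

Proof: by the group theory of `Literature.GroupTheory.SquareCentralProofs`, `T` is the disjoint
union of `Z` and of the conjugation orbits `O_a = {y a z y⁻¹}` of finitely many cosets `a Z`
(`exists_finset_orbits_sq_mem`); each part is conjugation-stable, so a prime whose Frobenius class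
lies in `T` has it in one of the parts (`filter_natPrimesOf_primesOfFrobIn_subset`, from the tree's
`mem_primesOfFrobIn_iff_exists`: all Frobenius elements over an unramified prime are conjugate);
the one-subgroup bound applies to `Z` with `H = Z`, `k = [G : Z]` (bound `#Z/#G`) and to `O_a` with
`H = ⟨a⟩Z`, `k = [Stab(aZ) : ⟨a⟩Z]` (bound `≤ 2 #O_a/#G`, `one_div_le_two_mul_natCard_orbit_div`);
summing, `#Z/#G + Σ_a 2 #O_a/#G ≤ 2 #T/#G`.

This is the Chebotarev input of the `ℓ`-adic proof (Serre, *Abelian ℓ-adic representations and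
elliptic curves* (1968), IV-13, Exercise) that the supersingular primes of a non-CM elliptic curve
over `ℚ` have density zero (`Literature/NumberTheory/EllipticCurves/SupersingularDensity*`).

## References

* J.-P. Serre, *Quelques applications du théorème de densité de Chebotarev*, Publ. Math. IHÉS 54
  (1981), §2.1 (Thm. 1, eq. (9): natural density). [Serre1981]
* D. A. Marcus, *Number Fields*, 2nd ed., Springer 2018, Ch. 4, Thm. 33. [Marcus2018]
-/

noncomputable section

open Filter IsDedekindDomain
open scoped NumberField Topology Classical Pointwise

namespace Literature.NumberTheory.LFunctions.Chebotarev

open Field GaloisRepresentations Rat.HeightOneSpectrum NumberField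
  Literature.GroupTheory.SquareCentral

/-! ### Finite level -/

section FiniteLevel

variable {L : Type} [Field L] [instNF : NumberField L] {instAlg : Algebra ℚ L}
  [instGal : IsGalois ℚ L]

/-- **Absorbing finitely many exceptional primes.**  If the primes below `primesOfFrobIn ℚ L C`
have counting function eventually `≤ (a + η) π(x)` for every `η > 0`, and `S ⊆ ℕ` has the same
primes as `primesOfFrobIn ℚ L C` outside a finite set `T` of places, then also
`#{p ≤ x : p ∈ S} ≤ (a + η) π(x)` eventually, for every `η > 0` (the exceptions are `o(π(x))`,
Mathlib `Nat.tendsto_primeCounting`).  Same proof as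
`eventually_card_primesLE_filter_le_of_frobCondition`. [cite: Serre1981, §2.1 Thm. 1 eq. (9)] -/
theorem eventually_card_primesLE_filter_le_of_frobCondition_of_forall [FiniteDimensional ℚ L]
    {C : Set (L ≃ₐ[ℚ] L)} {a : ℝ}
    (hC : ∀ η : ℝ, 0 < η → ∀ᶠ x : ℕ in atTop,
      ((((Nat.primesLE x).filter (· ∈ natPrimesOf (primesOfFrobIn ℚ L C))).card : ℝ)) ≤
        (a + η) * Nat.primeCounting x)
    {S : Set ℕ} {T : Set (HeightOneSpectrum (𝓞 ℚ))} (hT : T.Finite)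
    (hagree : ∀ v ∉ T, ((primesEquiv v : Nat.Primes) : ℕ) ∈ S ↔ v ∈ primesOfFrobIn ℚ L C)
    {η : ℝ} (hη : 0 < η) :
    ∀ᶠ x : ℕ in atTop,
      ((((Nat.primesLE x).filter (· ∈ S)).card : ℝ)) ≤ (a + η) * Nat.primeCounting x := by
  have h1 := hC (η / 2) (half_pos hη)
  have hTfin : (natPrimesOf T).Finite := natPrimesOf_finite hT
  have h2 : ∀ᶠ x : ℕ in atTop, ((hTfin.toFinset.card : ℝ)) ≤ (η / 2) * Nat.primeCounting x := by
    have hlim : Tendsto (fun x : ℕ ↦ (η / 2) * (Nat.primeCounting x : ℝ)) atTop atTop :=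
      (tendsto_natCast_atTop_atTop.comp Nat.tendsto_primeCounting).const_mul_atTop (half_pos hη)
    exact hlim.eventually (eventually_ge_atTop _)
  filter_upwards [h1, h2] with x hx hx2
  -- `filter S ⊆ filter (natPrimesOf (primesOfFrobIn ℚ L C)) ∪ natPrimesOf T`
  have hsub : (Nat.primesLE x).filter (· ∈ S) ⊆
      (Nat.primesLE x).filter (· ∈ natPrimesOf (primesOfFrobIn ℚ L C)) ∪ hTfin.toFinset := by
    intro p hp
    rw [Finset.mem_filter, Nat.mem_primesLE] at hp
    obtain ⟨⟨hpx, hpp⟩, hpS⟩ := hp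
    rw [Finset.mem_union, Finset.mem_filter, Nat.mem_primesLE, Set.Finite.mem_toFinset]
    by_cases hvT : primesEquiv.symm ⟨p, hpp⟩ ∈ T
    · right
      exact ⟨_, hvT, by rw [Equiv.apply_symm_apply]⟩
    · left
      refine ⟨⟨hpx, hpp⟩, ?_⟩
      set v : HeightOneSpectrum (𝓞 ℚ) := primesEquiv.symm ⟨p, hpp⟩ with hv
      have hpv : ((primesEquiv v : Nat.Primes) : ℕ) = p := by rw [hv, Equiv.apply_symm_apply]
      rw [← hpv, primesEquiv_mem_natPrimesOf_iff, ← hagree v hvT, hpv]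
      exact hpS
  have hcard := (Finset.card_le_card hsub).trans (Finset.card_union_le _ _)
  have hcardR : ((((Nat.primesLE x).filter (· ∈ S)).card : ℝ)) ≤
      ((Nat.primesLE x).filter (· ∈ natPrimesOf (primesOfFrobIn ℚ L C))).card +
        hTfin.toFinset.card := by exact_mod_cast hcard
  calc ((((Nat.primesLE x).filter (· ∈ S)).card : ℝ))
      ≤ ((Nat.primesLE x).filter (· ∈ natPrimesOf (primesOfFrobIn ℚ L C))).card +
          hTfin.toFinset.card := hcardR
    _ ≤ (a + η / 2) * Nat.primeCounting x + (η / 2) * Nat.primeCounting x := add_le_add hx hx2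
    _ = (a + η) * Nat.primeCounting x := by ring

/-- **Subadditivity of Frobenius sets over conjugation-stable parts.**  If the conjugation-stable
set `C ⊆ Gal(L/ℚ)` is covered by conjugation-stable sets `P i` (`i ∈ s`), then every prime below
`primesOfFrobIn ℚ L C` lies below `primesOfFrobIn ℚ L (P i)` for some `i ∈ s`: all the Frobenius
elements over an unramified prime form one conjugacy class (`mem_primesOfFrobIn_iff_exists`).
[cite: Marcus2018, Ch. 4, Thm. 33] -/
theorem filter_natPrimesOf_primesOfFrobIn_subset_biUnion {ι : Type*} (s : Finset ι)
    (P : ι → Set (L ≃ₐ[ℚ] L)) (hP : ∀ i ∈ s, ∀ g h : L ≃ₐ[ℚ] L, h ∈ P i → g * h * g⁻¹ ∈ P i)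
    {C : Set (L ≃ₐ[ℚ] L)} (hC : ∀ g h : L ≃ₐ[ℚ] L, h ∈ C → g * h * g⁻¹ ∈ C)
    (hcover : ∀ σ ∈ C, ∃ i ∈ s, σ ∈ P i) (x : ℕ) :
    (Nat.primesLE x).filter (· ∈ natPrimesOf (primesOfFrobIn ℚ L C)) ⊆
      s.biUnion fun i ↦ (Nat.primesLE x).filter (· ∈ natPrimesOf (primesOfFrobIn ℚ L (P i))) := by
  intro p hp
  rw [Finset.mem_filter] at hp
  obtain ⟨hpx, v, hv, rfl⟩ := hp
  obtain ⟨σ, hσC, hvσ⟩ := (mem_primesOfFrobIn_iff_exists hC).mp hv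
  obtain ⟨i, hi, hσi⟩ := hcover σ hσC
  rw [Finset.mem_biUnion]
  refine ⟨i, hi, ?_⟩
  rw [Finset.mem_filter, primesEquiv_mem_natPrimesOf_iff]
  exact ⟨hpx, (mem_primesOfFrobIn_iff_exists (hP i hi)).mpr ⟨σ, hσi, hvσ⟩⟩

/-- **Upper natural density `≤ 2 #T/#G` for `T = {σ : σ² ∈ Z}`, `Z` central (finite level).**
For `L/ℚ` finite Galois with group `G`, a central subgroup `Z ≤ G` and every `η > 0`, eventually
`#{p ≤ x : p below primesOfFrobIn ℚ L {σ : σ² ∈ Z}} ≤ (2 #{σ : σ² ∈ Z}/#G + η) π(x)`.  Proof: the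
parts `Z` and `O_a` (`a ∈` a system of representatives, `exists_finset_orbits_sq_mem`) are
conjugation-stable with one-subgroup bounds `#Z/#G` (`index_mul_natCard_le_natCard_conj_mem`) and
`≤ 2 #O_a/#G` (`div_mul_natCard_le_natCard_conj_mem`, `one_div_le_two_mul_natCard_orbit_div`); sum
them (`filter_natPrimesOf_primesOfFrobIn_subset_biUnion`). [cite: Serre1981, §2.1 Thm. 1 eq. (9)] -/
theorem eventually_card_primesLE_filter_natPrimesOf_primesOfFrobIn_sqCentral_le
    [FiniteDimensional ℚ L] (Z : Subgroup (L ≃ₐ[ℚ] L)) (hZ : Z ≤ Subgroup.center (L ≃ₐ[ℚ] L))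
    {η : ℝ} (hη : 0 < η) :
    ∀ᶠ x : ℕ in atTop,
      ((((Nat.primesLE x).filter
          (· ∈ natPrimesOf (primesOfFrobIn ℚ L {σ | σ ^ 2 ∈ Z}))).card : ℝ)) ≤
        (2 * Nat.card {σ : L ≃ₐ[ℚ] L // σ ^ 2 ∈ Z} / Nat.card (L ≃ₐ[ℚ] L) + η) *
          Nat.primeCounting x := by
  classical
  obtain ⟨𝒪, h𝒪, hcov, hsum⟩ := exists_finset_orbits_sq_mem (G := L ≃ₐ[ℚ] L) hZ
  set N : ℕ := Nat.card (L ≃ₐ[ℚ] L) with hN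
  have hNpos : (0 : ℝ) < N := by exact_mod_cast (Nat.card_pos (α := L ≃ₐ[ℚ] L))
  set η' : ℝ := η / (𝒪.card + 1) with hη'
  have h𝒪pos : (0 : ℝ) < 𝒪.card + 1 := by positivity
  have hη'pos : 0 < η' := div_pos hη h𝒪pos
  -- the orbit parts
  have hO : ∀ A ∈ 𝒪, ∀ᶠ x : ℕ in atTop,
      ((((Nat.primesLE x).filter
          (· ∈ natPrimesOf (primesOfFrobIn ℚ L (↑A : Set (L ≃ₐ[ℚ] L))))).card : ℝ)) ≤
        (2 * A.card / N + η') * Nat.primeCounting x := by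
    intro A hA
    obtain ⟨a, ha2, -, hmem⟩ := h𝒪 A hA
    have hk := div_natCard_zpowers_sup_pos hZ a
    have hCk : ∀ g ∈ (↑A : Set (L ≃ₐ[ℚ] L)),
        Nat.card (Subgroup.normalizer (a • (Z : Set (L ≃ₐ[ℚ] L)))) /
            Nat.card (Subgroup.zpowers a ⊔ Z : Subgroup (L ≃ₐ[ℚ] L)) *
          Nat.card (Subgroup.zpowers a ⊔ Z : Subgroup (L ≃ₐ[ℚ] L)) ≤
          Nat.card {y : L ≃ₐ[ℚ] L // y⁻¹ * g * y ∈ Subgroup.zpowers a ⊔ Z} :=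
      fun g hg ↦ div_mul_natCard_le_natCard_conj_mem hZ ((hmem g).mp hg)
    have h1 := eventually_card_primesLE_filter_natPrimesOf_primesOfFrobIn_le_of_subgroup
      (Subgroup.zpowers a ⊔ Z) hk hCk hη'pos
    have hbound := one_div_le_two_mul_natCard_orbit_div hZ ha2
    have hcardA : Nat.card {x : L ≃ₐ[ℚ] L // ∃ y : L ≃ₐ[ℚ] L, ∃ z ∈ Z, x = y * (a * z) * y⁻¹} =
        A.card := by
      rw [← Nat.card_eq_finsetCard]
      exact Nat.card_congr (Equiv.subtypeEquivRight fun x ↦ (hmem x).symm)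
    rw [hcardA] at hbound
    filter_upwards [h1] with x hx
    exact hx.trans (mul_le_mul_of_nonneg_right (add_le_add hbound le_rfl) (Nat.cast_nonneg _))
  -- the centre part
  have hZp : ∀ᶠ x : ℕ in atTop,
      ((((Nat.primesLE x).filter
          (· ∈ natPrimesOf (primesOfFrobIn ℚ L (Z : Set (L ≃ₐ[ℚ] L))))).card : ℝ)) ≤
        (Nat.card Z / N + η') * Nat.primeCounting x := by
    have hk : 0 < Z.index := Nat.pos_of_ne_zero Z.index_ne_zero_of_finite
    have hCk : ∀ g ∈ (Z : Set (L ≃ₐ[ℚ] L)),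
        Z.index * Nat.card Z ≤ Nat.card {y : L ≃ₐ[ℚ] L // y⁻¹ * g * y ∈ Z} :=
      fun g hg ↦ index_mul_natCard_le_natCard_conj_mem hZ hg
    have h1 := eventually_card_primesLE_filter_natPrimesOf_primesOfFrobIn_le_of_subgroup Z hk hCk
      hη'pos
    rw [one_div_index_eq Z] at h1
    exact h1
  -- combine over the decomposition `T = Z ⊔ ⨆ O`
  have hall := (Filter.eventually_all_finset 𝒪).mpr hO
  filter_upwards [hall, hZp] with x hx hxZ
  have hconjZ : ∀ g h : L ≃ₐ[ℚ] L, h ∈ (Z : Set (L ≃ₐ[ℚ] L)) → g * h * g⁻¹ ∈ (Z : Set (L ≃ₐ[ℚ] L)) :=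
    fun g h hh ↦ by
      rw [SetLike.mem_coe, conj_eq_of_le_center hZ hh g]
      exact hh
  have hconjT : ∀ g h : L ≃ₐ[ℚ] L, h ∈ {σ : L ≃ₐ[ℚ] L | σ ^ 2 ∈ Z} →
      g * h * g⁻¹ ∈ {σ : L ≃ₐ[ℚ] L | σ ^ 2 ∈ Z} := fun g h hh ↦ by
    haveI := normal_of_le_center hZ
    rw [Set.mem_setOf_eq, conj_pow]
    exact Subgroup.Normal.conj_mem inferInstance _ hh g
  -- parts indexed by `Option (Finset G)`: `none ↦ Z`, `some A ↦ A`
  set P : Option (Finset (L ≃ₐ[ℚ] L)) → Set (L ≃ₐ[ℚ] L) := fun o ↦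
    o.elim (Z : Set (L ≃ₐ[ℚ] L)) (fun A ↦ (↑A : Set (L ≃ₐ[ℚ] L))) with hP
  set s : Finset (Option (Finset (L ≃ₐ[ℚ] L))) := insert none (𝒪.image some) with hs
  have hPconj : ∀ o ∈ s, ∀ g h : L ≃ₐ[ℚ] L, h ∈ P o → g * h * g⁻¹ ∈ P o := by
    intro o ho g h hh
    rw [hs, Finset.mem_insert, Finset.mem_image] at ho
    rcases ho with rfl | ⟨A, hA, rfl⟩
    · exact hconjZ g h hh
    · obtain ⟨a, -, -, hmem⟩ := h𝒪 A hA
      change g * h * g⁻¹ ∈ (↑A : Set (L ≃ₐ[ℚ] L))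
      rw [Finset.mem_coe, hmem]
      exact conj_mem_orbit hZ g ((hmem h).mp hh)
  have hcover : ∀ σ ∈ {σ : L ≃ₐ[ℚ] L | σ ^ 2 ∈ Z}, ∃ o ∈ s, σ ∈ P o := by
    intro σ hσ
    by_cases hσZ : σ ∈ Z
    · exact ⟨none, by rw [hs]; exact Finset.mem_insert_self _ _, hσZ⟩
    · obtain ⟨A, hA, hσA⟩ := hcov σ hσ hσZ
      refine ⟨some A, ?_, Finset.mem_coe.mpr hσA⟩
      rw [hs, Finset.mem_insert, Finset.mem_image]
      exact Or.inr ⟨A, hA, rfl⟩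
  have hsub := filter_natPrimesOf_primesOfFrobIn_subset_biUnion s P hPconj hconjT hcover x
  have hcard := (Finset.card_le_card hsub).trans Finset.card_biUnion_le
  have hsplit : ∑ o ∈ s, ((Nat.primesLE x).filter
      (· ∈ natPrimesOf (primesOfFrobIn ℚ L (P o)))).card =
      ((Nat.primesLE x).filter (· ∈ natPrimesOf (primesOfFrobIn ℚ L (Z : Set (L ≃ₐ[ℚ] L))))).card +
        ∑ A ∈ 𝒪, ((Nat.primesLE x).filter
          (· ∈ natPrimesOf (primesOfFrobIn ℚ L (↑A : Set (L ≃ₐ[ℚ] L))))).card := by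
    rw [hs, Finset.sum_insert (by simp), Finset.sum_image (fun A _ B _ h ↦ Option.some_injective _ h)]
    rfl
  rw [hsplit] at hcard
  have hcardR : ((((Nat.primesLE x).filter
      (· ∈ natPrimesOf (primesOfFrobIn ℚ L {σ | σ ^ 2 ∈ Z}))).card : ℝ)) ≤
      ((Nat.primesLE x).filter (· ∈ natPrimesOf (primesOfFrobIn ℚ L (Z : Set (L ≃ₐ[ℚ] L))))).card +
        ∑ A ∈ 𝒪, (((Nat.primesLE x).filter
          (· ∈ natPrimesOf (primesOfFrobIn ℚ L (↑A : Set (L ≃ₐ[ℚ] L))))).card : ℝ) := by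
    exact_mod_cast hcard
  have hsumR : ∑ A ∈ 𝒪, (((Nat.primesLE x).filter
      (· ∈ natPrimesOf (primesOfFrobIn ℚ L (↑A : Set (L ≃ₐ[ℚ] L))))).card : ℝ) ≤
      ∑ A ∈ 𝒪, (2 * A.card / N + η') * Nat.primeCounting x :=
    Finset.sum_le_sum fun A hA ↦ hx A hA
  have hπ : (0 : ℝ) ≤ Nat.primeCounting x := Nat.cast_nonneg _
  -- `#Z + 2 Σ #A ≤ 2 #T`
  have hTot : (Nat.card Z : ℝ) + 2 * ∑ A ∈ 𝒪, (A.card : ℝ) ≤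
      2 * Nat.card {σ : L ≃ₐ[ℚ] L // σ ^ 2 ∈ Z} := by
    have h : ((∑ A ∈ 𝒪, A.card + Nat.card Z : ℕ) : ℝ) ≤ Nat.card {σ : L ≃ₐ[ℚ] L // σ ^ 2 ∈ Z} := by
      exact_mod_cast hsum
    push_cast at h
    have hZnn : (0 : ℝ) ≤ Nat.card Z := Nat.cast_nonneg _
    linarith
  calc ((((Nat.primesLE x).filter
          (· ∈ natPrimesOf (primesOfFrobIn ℚ L {σ | σ ^ 2 ∈ Z}))).card : ℝ))
      ≤ (Nat.card Z / N + η') * Nat.primeCounting x +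
          ∑ A ∈ 𝒪, (2 * A.card / N + η') * Nat.primeCounting x :=
        hcardR.trans (add_le_add hxZ hsumR)
    _ = ((Nat.card Z + 2 * ∑ A ∈ 𝒪, (A.card : ℝ)) / N + (𝒪.card + 1) * η') *
          Nat.primeCounting x := by
        have e1 : ∑ A ∈ 𝒪, (2 * (A.card : ℝ) / N + η') * Nat.primeCounting x =
            (∑ A ∈ 𝒪, (2 * (A.card : ℝ) / N + η')) * Nat.primeCounting x := by
          rw [Finset.sum_mul]
        have e2 : ∑ A ∈ 𝒪, (2 * (A.card : ℝ) / N + η') =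
            2 * (∑ A ∈ 𝒪, (A.card : ℝ)) / N + 𝒪.card * η' := by
          rw [Finset.sum_add_distrib, Finset.sum_const, nsmul_eq_mul, ← Finset.sum_div,
            Finset.mul_sum]
        rw [e1, e2]
        ring
    _ ≤ (2 * Nat.card {σ : L ≃ₐ[ℚ] L // σ ^ 2 ∈ Z} / N + η) * Nat.primeCounting x := by
        refine mul_le_mul_of_nonneg_right (add_le_add ?_ ?_) hπ
        · exact div_le_div_of_nonneg_right hTot hNpos.le
        · rw [hη', mul_div_cancel₀ _ h𝒪pos.ne']

end FiniteLevel

/-! ### The `Γ_ℚ`-form -/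

/-- **Upper natural density `≤ 2 #T/#G` for the Frobenius set of `T = {g : g² ∈ Z}`, `Γ_ℚ`-form.**
Let `φ : Γ_ℚ ↠ G` be a surjection onto a finite group with open kernel and `Z ≤ Z(G)` a central
subgroup.  Then for every `η > 0`, eventually
`#{p ≤ x : p ∈ frobPrimes φ {g : g² ∈ Z}} ≤ (2 #{g : g² ∈ Z}/#G + η) π(x)`.  Proof: pass to
`L = ℚ̄^{ker φ}` with `exists_intermediateField_mulEquiv_frobCondition_iff`, transport `Z` and `T`
along `Ψ : Gal(L/ℚ) ≃* G`, apply the finite-level bound and absorb the finitely many ramified primes.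
Unconditional (prime ideal theorem only). [cite: Serre1981, §2.1 Thm. 1 eq. (9)] -/
theorem eventually_card_primesLE_filter_frobPrimes_sqCentral_le {G : Type*} [Group G] [Finite G]
    (φ : absoluteGaloisGroup ℚ →* G)
    (hker : IsOpen (φ.ker : Set (absoluteGaloisGroup ℚ))) (hsurj : Function.Surjective φ)
    (Z : Subgroup G) (hZ : Z ≤ Subgroup.center G) {η : ℝ} (hη : 0 < η) :
    ∀ᶠ x : ℕ in atTop,
      ((((Nat.primesLE x).filter (· ∈ frobPrimes φ {g | g ^ 2 ∈ Z})).card : ℝ)) ≤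
        (2 * Nat.card {g : G // g ^ 2 ∈ Z} / Nat.card G + η) * Nat.primeCounting x := by
  obtain ⟨L, hfd, hgal, hnf, Ψ, T, hT, hagree⟩ :=
    exists_intermediateField_mulEquiv_frobCondition_iff φ hker hsurj
  haveI := hfd
  haveI := hgal
  haveI := hnf
  -- transport the central subgroup and the set along `Ψ` (no fresh `L ≃ₐ[ℚ] L`: the `Algebra ℚ L`
  -- instance must be the one carried by `Ψ`)
  set Z' := Z.comap Ψ.toMonoidHom with hZ'
  have hmemZ' : ∀ σ, σ ∈ Z' ↔ Ψ σ ∈ Z := fun σ ↦ by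
    rw [hZ', Subgroup.mem_comap, MulEquiv.coe_toMonoidHom]
  have hZ'c : Z' ≤ Subgroup.center _ := by
    intro z hz
    rw [hmemZ'] at hz
    rw [Subgroup.mem_center_iff]
    intro g
    apply Ψ.injective
    rw [map_mul, map_mul]
    exact Subgroup.mem_center_iff.mp (hZ hz) (Ψ g)
  have hpre : Ψ ⁻¹' {g : G | g ^ 2 ∈ Z} = {σ | σ ^ 2 ∈ Z'} := by
    ext σ
    rw [Set.mem_preimage, Set.mem_setOf_eq, Set.mem_setOf_eq, hmemZ', map_pow]
  have hcardT : Nat.card {σ // σ ^ 2 ∈ Z'} = Nat.card {g : G // g ^ 2 ∈ Z} := by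
    refine Nat.card_congr (Ψ.toEquiv.subtypeEquiv fun σ ↦ ?_)
    rw [hmemZ', map_pow]
    rfl
  have hcardG : Nat.card _ = Nat.card G := Nat.card_congr Ψ.toEquiv
  have hC := fun η' (hη' : 0 < η') ↦
    eventually_card_primesLE_filter_natPrimesOf_primesOfFrobIn_sqCentral_le Z' hZ'c hη'
  rw [hcardT, hcardG] at hC
  exact eventually_card_primesLE_filter_le_of_frobCondition_of_forall hC hT
    (fun v hv ↦ primesEquiv_mem_frobPrimes_iff.trans ((hagree _ v hv).trans (by rw [hpre]))) hη

end Literature.NumberTheory.LFunctions.Chebotarev
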